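import Mathlib

/-!
# SoloBlind — the linear decoupling step of LEMMA S (kernel #169)

For the two-block linear system `r' = λ r + g w`, `w' = D w + r • f` (a scalar slow variable `r`
coupled to a complement `w`), the substitution `w = r • V + w₁` with `V' = D V - λ • V + f`
produces EXACTLY `r' = (λ + g V) r + g w₁` and `w₁' = D w₁ - (g w₁) • V - (r * g V) • V`:
the new coupling `r → w₁` is `-(g V) • V`, quadratic in the previous correction (Newton-like
convergence of the hierarchy, paper §24.99(16)). Pure module algebra: derivatives enter as data.
-/

namespace Summit.AnomalousDissipation.AnomalousDissipation.Theorems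

variable {R M : Type*} [CommRing R] [AddCommGroup M] [Module R M]

/-- The slow equation after one decoupling step: `r' = (λ + g V) r + g w₁`. -/
theorem decouplingStep_slow (r r' lam : R) (w V w₁ : M) (g : M →ₗ[R] R)
    (hw : w = r • V + w₁) (hr : r' = lam * r + g w) :
    r' = (lam + g V) * r + g w₁ := by
  rw [hr, hw, map_add, map_smul, smul_eq_mul]
  ring

/-- The complement equation after one decoupling step:
`w₁' = w' - r • V' - r' • V = D w₁ - (g w₁) • V - (r * g V) • V`. -/
theorem decouplingStep_complement (r r' lam : R) (w w' V V' f w₁ : M)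
    (g : M →ₗ[R] R) (D : M →ₗ[R] M)
    (hw : w = r • V + w₁) (hr : r' = lam * r + g w) (hw' : w' = D w + r • f)
    (hV : V' = D V - lam • V + f) :
    w' - r • V' - r' • V = D w₁ - (g w₁) • V - (r * g V) • V := by
  have hr' : r' = (lam + g V) * r + g w₁ := decouplingStep_slow r r' lam w V w₁ g hw hr
  subst hw
  rw [hw', hV, hr', map_add, map_smul]
  module

/-- The new coupling is quadratic in the correction: if `g V = ε` then the `r`-coefficient of the
complement equation is `-(r * ε) • V`, i.e. `f₁ = -ε • V`. -/
theorem decouplingStep_coupling (r eps : R) (V : M) (g : M →ₗ[R] R) (hgV : g V = eps) :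
    -((r * g V) • V) = r • (-(eps • V)) := by
  rw [hgV, smul_neg, smul_smul]

end Summit.AnomalousDissipation.AnomalousDissipation.Theorems
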